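import Summits.AtomisticToContinuum.HydrodynamicLimit.Theorems.AntiMazurCoboundariesCorrectorPressureDecayEquivalences
import Summits.AtomisticToContinuum.HydrodynamicLimit.Theorems.AntiMazurCoboundariesKineticFluxLdDecayObjects
import HarnessLib

/-!
# Skeleton — crux `CorrectorPressureDecay` (stmt-AtomisticToContinuum-14135, "X"), line `coarse-doob-dock`

Second-opinion crux-strategist `planner-cstrat-stmt-AtomisticToContinuum-14135-r1-0`, 2026-08-17.
Line card: `Cruxes/CorrectorPressureDecay/Lines/coarse_doob_dock.md`.

WHAT THIS LINE IS. The twin crux stmt-10967 `KineticFluxLdDecay` (ONE statement with X: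
`correctorPressureDecay_iff_kineticFluxLdDecay`, p99142) received at 2026-08-17T13:3xZ the strategist line
`Cruxes/KineticFluxLdDecay/Lines/coarse_doob_corrector.lean` (seat cstrat-10967-p1): Doob–Gordin split of the
LOCAL-EQUILIBRIUM-SUBTRACTED fast window sum along the COARSE ROUND FILTRATION, `crux ⟸ S1 ∧ S2 ∧ S3` via a dock S4.
This file DOCKS that architecture onto X and REPAIRS the quantifier order of its two dynamical stubs:

* FINDING (r1, paper; card §Audit): S2 `CellConditionedRelaxation` AS TYPED on 10967 — `∃ C_D ∃ N₀ ∀ N ≥ N₀ ∀ Φ ∀ m`,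
  the horizon `m` AFTER `N` with an `m`-uniform constant — is FALSE: condition `𝓕_0` on a MACROSCOPIC shear profile
  `u_y = û√θ sin(2πx₁)` (cost `≈ c û²(N+1) < C_*(N+1)` for small `û`, hence non-exceptional); the first-order
  Chapman–Enskog stress `⟨h⟩ ≈ −c_h t_rel ∂ₓu_y` is NOT removed by the zeroth-order local-equilibrium subtraction
  `Γ_g(û_c, θ̂_c)` (which vanishes for a drift `⊥ x` by `w_x`-oddness) and persists for the viscous lifetime
  `≍ σ²(N+1)^{2/3}/k²` rounds, so `|E[S_m | 𝓕_0]| ≍ û φ̂ b (N+1)^{4/3}/(σ⁰ k)` for `m ≳ σ²N^{2/3}` — not `≤ C_D b (N+1)`.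
  (It is the equilibrium two-time correlation of `F` with the slow shear mode: linear response × hydrodynamic lifetime.)
* REPAIR (typed here): `CellConditionedRelaxationFH` (S2′) and `ConditionalRevisionsFH` (S3′) quantify `∀ m ∃ N₀(m)` —
  the horizon is fixed BEFORE `N → ∞`, the constants `C_D, V, C_Ξ, λ₀` still independent of `m`. This is all the dock
  consumes (`RoundWindowDecay` is `∀ δ ∃ m₀ ∀ m ≥ m₀ ∃ N₀ ∀ N`): at fixed `m` the macroscopic wave contributes
  `m·O((N+1)^{-1/3}) → 0` per particle and mesoscopic waves are cancelled by the macroscopic weight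
  (`Σᵢ φ(xᵢ)∂ₓu_y(xᵢ) = −(N+1)∫u_y ∂ₓφ`, `O(û‖∇φ‖(N+1)^{-1/3})` per particle).

Registered stubs (sorries ONLY here): `stub_slowSectorStatics` (S1, verbatim the 10967 statement, re-declared in this
namespace because crux workfiles are not importable modules on the farm), `stub_cellConditionedRelaxationFH` (S2′),
`stub_conditionalRevisionsFH` (S3′), `stub_dockFH` (S4′: S1 → S2′ → S3′ → `RoundWindowDecay`). Composition (§ 3,
sorry-free): `RoundWindowDecay → KineticFluxLdDecay` (choice `τ := m₀ d`, as on 10967) `→ CorrectorPressureDecay`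
(p99142's half `correctorPressureDecay_of_kineticFluxLdDecay`), concluding X BY NAME.

SHARED LINE — STAFF ONCE. § 1 (objects) and the statements S1, `RoundWindowDecay` are byte-for-byte those of the 10967
skeleton (credit: cstrat-10967-p1); a proof of either copy transfers by `Iff.rfl`-level rewriting. The lead of 10967's
`coarse_doob_corrector` should adopt the FH order for S2/S3 (its dock uses nothing more); a second lead on this file
would duplicate that seat.
-/

noncomputable section

open MeasureTheory ProbabilityTheory Set Filter
open scoped ENNReal BigOperators Classical

namespace Summit.AtomisticToContinuum.HydrodynamicLimit.Cruxes.CorrectorPressureDecay.CoarseDoobDock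

open Literature.MathematicalPhysics.KineticTheory (T3 V3 hsDiameter localGibbsLaw)
open Literature.Analysis.FluidPDE (HardSphereFlow Config)
open Summit.AtomisticToContinuum.HydrodynamicLimit.Theorems.DynkinAzuma
  (Flow Phase gibbs ell window sv obsA bin binVal binVec)
open Summit.AtomisticToContinuum.HydrodynamicLimit.Theses.AntiMazurCoboundaries (CorrectorPressureDecay
  KineticFluxLdDecay)

/-! ## § 1 Objects of the line (verbatim from `Cruxes/KineticFluxLdDecay/Lines/coarse_doob_corrector.lean` § 1,
cstrat-10967-p1; re-declared, not imported: crux workfiles are not built as importable modules) -/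

/-- Admissible observable data at amplitude `b`: `φ` continuous with `|φ| ≤ 1`, `g` continuous with
`|g| ≤ b` and `g ⊥ span{1, v, |v|²}` in `L²(stdGaussian)` (the crux's clauses, verbatim). -/
def Adm (b : ℝ) (φ : T3 → ℝ) (g : V3 → ℝ) : Prop :=
  Continuous φ ∧ Continuous g ∧ (∀ x, |φ x| ≤ 1) ∧ (∀ v, |g v| ≤ b) ∧
    ∀ (c₀ c₂ : ℝ) (e : V3), ∫ v, g v * (c₀ + inner ℝ e v + c₂ * ‖v‖ ^ 2) ∂(stdGaussian V3) = 0

/-- The parameter regime of the coarse apparatus: cell side `Λ ℓ_N` with `Λ ≥ 1`, velocity-bin mesh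
`δv ∈ (0,1]` (thermal units), gain-bin mesh `δg ∈ (0,1]`, round length `Δ = d ℓ_N` with
`d √θ ∈ [1/2, 1]`. -/
def ParamsOK (θ Λ δv δg d : ℝ) : Prop :=
  1 ≤ Λ ∧ 0 < δv ∧ δv ≤ 1 ∧ 0 < δg ∧ δg ≤ 1 ∧ 1 / 2 ≤ d * Real.sqrt θ ∧ d * Real.sqrt θ ≤ 1

/-- The round gain of particle `i`: `η_i(z) = Δ⁻¹ ∫₀^Δ φ(x_i(s)) g(w_i(s)) ds`, `Δ = window d N = d ℓ_N`
(guarded by the good set of the flow: junk `0` off `Φ.good`, a `G_N`-null set). -/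
def gain (θ : ℝ) (u₀ : V3) (φ : T3 → ℝ) (g : V3 → ℝ) (d : ℝ) {σ : ℝ} {N : ℕ} (Φ : Flow σ N)
    (i : Fin (N + 1)) (z : Phase N) : ℝ :=
  if z ∈ Φ.good then
    (window d N)⁻¹ * ∫ s in (0 : ℝ)..window d N, φ (Φ.flow s z i).1 * g (sv θ u₀ (Φ.flow s z i).2)
  else 0

/-- The mesoscopic cell label of particle `i` (cells of side `Λ ℓ_N` on `𝕋³`). -/
def cellOf (Λ : ℝ) {N : ℕ} (z : Phase N) (i : Fin (N + 1)) : Fin 3 → ℤ :=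
  Literature.Analysis.FluidPDE.Torus.coarseCell (Λ * ell N) (z i).1

/-- The particles sharing particle `i`'s cell (contains `i`). -/
def cellMates (Λ : ℝ) {N : ℕ} (z : Phase N) (i : Fin (N + 1)) : Finset (Fin (N + 1)) :=
  Finset.univ.filter fun j => cellOf Λ z j = cellOf Λ z i

/-- Empirical scaled drift of particle `i`'s cell: `û = n_c⁻¹ Σ_{j ∈ cell} w_j`. -/
def cellDrift (θ : ℝ) (u₀ : V3) (Λ : ℝ) {N : ℕ} (z : Phase N) (i : Fin (N + 1)) : V3 :=
  ((cellMates Λ z i).card : ℝ)⁻¹ • ∑ j ∈ cellMates Λ z i, sv θ u₀ (z j).2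

/-- Empirical scaled temperature of particle `i`'s cell: `θ̂ = (3 n_c)⁻¹ Σ_{j ∈ cell} ‖w_j - û‖²`. -/
def cellTemp (θ : ℝ) (u₀ : V3) (Λ : ℝ) {N : ℕ} (z : Phase N) (i : Fin (N + 1)) : ℝ :=
  (3 * ((cellMates Λ z i).card : ℝ))⁻¹ * ∑ j ∈ cellMates Λ z i, ‖sv θ u₀ (z j).2 - cellDrift θ u₀ Λ z i‖ ^ 2

/-- The local-equilibrium value of the velocity test `g` at scaled drift `u` and scaled temperature `t`:
`Γ_g(u,t) = ∫ g(√t w + u) dγ(w)` (vanishes to SECOND order at `(0,1)` for `g ⊥ {1, v, |v|²}`). -/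
def leValue (g : V3 → ℝ) (u : V3) (t : ℝ) : ℝ :=
  ∫ w, g (Real.sqrt t • w + u) ∂(stdGaussian V3)

/-- The slow (local-equilibrium) part of particle `i`'s gain: `φ(x_i) Γ_g(û_{c(i)}, θ̂_{c(i)})`. -/
def slowGainOf (θ : ℝ) (u₀ : V3) (φ : T3 → ℝ) (g : V3 → ℝ) (Λ : ℝ) {N : ℕ} (z : Phase N)
    (i : Fin (N + 1)) : ℝ :=
  φ (z i).1 * leValue g (cellDrift θ u₀ Λ z i) (cellTemp θ u₀ Λ z i)

/-- The slow gain `X_s = Σ_i φ(x_i) Γ_g(û_{c(i)}, θ̂_{c(i)})`. -/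
def slowGain (θ : ℝ) (u₀ : V3) (φ : T3 → ℝ) (g : V3 → ℝ) (Λ : ℝ) {N : ℕ} (z : Phase N) : ℝ :=
  ∑ i, slowGainOf θ u₀ φ g Λ z i

/-- The fast part of particle `i`'s round gain: `η^f_i = η_i - φ(x_i) Γ_g(û_{c(i)}, θ̂_{c(i)})`. -/
def fastGainOf (θ : ℝ) (u₀ : V3) (φ : T3 → ℝ) (g : V3 → ℝ) (Λ d : ℝ) {σ : ℝ} {N : ℕ} (Φ : Flow σ N)
    (z : Phase N) (i : Fin (N + 1)) : ℝ :=
  gain θ u₀ φ g d Φ i z - slowGainOf θ u₀ φ g Λ z i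

/-- The BINNED fast gain `X^b_f = Σ_i δg ⌊η^f_i / δg⌋` (within `(N+1) δg` of `Σ_i η^f_i`). -/
def fastGainBin (θ : ℝ) (u₀ : V3) (φ : T3 → ℝ) (g : V3 → ℝ) (Λ δg d : ℝ) {σ : ℝ} {N : ℕ}
    (Φ : Flow σ N) (z : Phase N) : ℝ :=
  ∑ i, binVal δg (fastGainOf θ u₀ φ g Λ d Φ z i)

/-- The coarse datum of particle `i` at the START of round `k`: cell label, velocity bin, and the bin label of its
fast gain over the PREVIOUS round (`0` for `k = 0`). Countable codomain. -/
def datum (θ : ℝ) (u₀ : V3) (φ : T3 → ℝ) (g : V3 → ℝ) (Λ δv δg d : ℝ) {σ : ℝ} {N : ℕ}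
    (Φ : Flow σ N) (k : ℕ) (z : Phase N) : Fin (N + 1) → (Fin 3 → ℤ) × (Fin 3 → ℤ) × ℤ :=
  fun i =>
    (cellOf Λ (Φ.flow (k * window d N) z) i,
     binVec δv (sv θ u₀ ((Φ.flow (k * window d N) z) i).2),
     if k = 0 then 0
     else bin δg (fastGainOf θ u₀ φ g Λ d Φ (Φ.flow ((k - 1 : ℕ) * window d N) z) i))

/-- The coarse HISTORY σ-algebra `𝓕_k` (data of rounds `0, …, k`, intersected with the Borel σ-algebra). -/
@[reducible] def histSigma (θ : ℝ) (u₀ : V3) (φ : T3 → ℝ) (g : V3 → ℝ) (Λ δv δg d : ℝ) {σ : ℝ} {N : ℕ}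
    (Φ : Flow σ N) (k : ℕ) : MeasurableSpace (Phase N) :=
  (⨆ j ∈ Finset.range (k + 1),
      MeasurableSpace.comap (datum θ u₀ φ g Λ δv δg d Φ j) inferInstance) ⊓ inferInstance

/-- The centred binned fast window sum over `m` rounds, `S^b_m(z) = Σ_{k<m} (X^b_f(Φ_{kΔ} z) - E_{G_N} X^b_f)`. -/
def fastWindowSum (a θ : ℝ) (u₀ : V3) (φ : T3 → ℝ) (g : V3 → ℝ) (Λ δg d : ℝ) {σ : ℝ} {N : ℕ}
    (Φ : Flow σ N) (m : ℕ) (z : Phase N) : ℝ :=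
  ∑ k ∈ Finset.range m,
    (fastGainBin θ u₀ φ g Λ δg d Φ (Φ.flow (k * window d N) z) -
      ∫ z', fastGainBin θ u₀ φ g Λ δg d Φ z' ∂(gibbs σ a θ u₀ N Φ))

/-- The Doob martingale of the fast window sum along the coarse history filtration: `M_j = E_{G_N}[S^b_m | 𝓕_j]`. -/
def doob (a θ : ℝ) (u₀ : V3) (φ : T3 → ℝ) (g : V3 → ℝ) (Λ δv δg d : ℝ) {σ : ℝ} {N : ℕ}
    (Φ : Flow σ N) (m j : ℕ) : Phase N → ℝ :=
  condExp (histSigma θ u₀ φ g Λ δv δg d Φ j) (gibbs σ a θ u₀ N Φ) (fastWindowSum a θ u₀ φ g Λ δg d Φ m)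

/-! ## § 2 Statements of the line -/

/-- S1 statement · SLOW-SECTOR STATICS (verbatim the 10967 statement; equal-time, provable-grade). -/
def SlowSectorStatics : Prop :=
  ∀ (a θ : ℝ) (u₀ : V3), 0 < a → 0 < θ → ∃ σ₀ : ℝ, 0 < σ₀ ∧ ∀ σ : ℝ, 0 < σ → σ < σ₀ →
    ∃ C : ℝ, 0 ≤ C ∧ ∃ c₀ : ℝ, 0 < c₀ ∧ ∀ Λ : ℝ, 1 ≤ Λ → ∀ (b : ℝ) (φ : T3 → ℝ) (g : V3 → ℝ), 0 < b → Adm b φ g →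
      ∃ N₀ : ℕ, ∀ N : ℕ, N₀ ≤ N → ∀ (Φ : Flow σ N) (lam : ℝ), |lam| * b ≤ c₀ →
        ∫ z, Real.exp (lam * (slowGain θ u₀ φ g Λ z - ∫ z', slowGain θ u₀ φ g Λ z' ∂(gibbs σ a θ u₀ N Φ)))
            ∂(gibbs σ a θ u₀ N Φ) ≤
          Real.exp (C * lam ^ 2 * b ^ 2 * ((N : ℝ) + 1) / Λ ^ 3)

/-- S2′ statement · CELL-CONDITIONED INTEGRATED RELAXATION IN THE MEAN AT A FIXED HORIZON (dynamical input 1,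
first moment; the r1 REPAIR of 10967's `CellConditionedRelaxation`): for all apparatus parameters in the regime and
every admissible `(φ, g)` at amplitude `b` there is `C_D` (independent of the horizon) such that FOR EVERY HORIZON `m`
THERE IS `N₀(m)` with: for `N ≥ N₀`, every flow, off an `𝓕_0`-measurable exceptional set of `G_N`-mass
`≤ e^{-C_*(N+1)}`, the equilibrium forecast of the centred binned fast window sum over `m` rounds given the INITIAL
coarse datum is bounded by `C_D b (N+1)`. (The 10967 order `∃N₀ ∀N ∀m` is refuted on paper by the macroscopic
shear-wave conditioning, file docstring; the dock needs only this order.) Content: integrated Boltzmann-type relaxation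
IN THE MEAN, uniformly in `N`, of every fast one-body structure a coarse-cell-conditioned equilibrium law of specific
entropy `≤ C_*` can encode, over a kinetic horizon of `m` rounds fixed before `N → ∞` but with an `m`-independent
bound. False for `σ = 0` and for `d = 1` rods. Open at fixed reduced density (no tool beyond the kinetic horizons
`T*(ε) ≍ (log|log ε|)^a` of Le Bihan 2022 Thm 1.3 / Deng–Hani–Ma 2024 Rem. 1.5(2)). -/
def CellConditionedRelaxationFH : Prop :=
  ∀ (a θ : ℝ) (u₀ : V3), 0 < a → 0 < θ → ∃ σ₀ : ℝ, 0 < σ₀ ∧ ∀ σ : ℝ, 0 < σ → σ < σ₀ →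
    ∃ Cstar : ℝ, 0 < Cstar ∧ ∀ (Λ δv δg d : ℝ), ParamsOK θ Λ δv δg d →
      ∀ (b : ℝ) (φ : T3 → ℝ) (g : V3 → ℝ), 0 < b → Adm b φ g →
        ∃ C_D : ℝ, 0 ≤ C_D ∧ ∀ m : ℕ, ∃ N₀ : ℕ, ∀ N : ℕ, N₀ ≤ N → ∀ (Φ : Flow σ N),
          ∃ B : Set (Phase N),
            MeasurableSet[histSigma θ u₀ φ g Λ δv δg d Φ 0] B ∧
            gibbs σ a θ u₀ N Φ B ≤ ENNReal.ofReal (Real.exp (-(Cstar * ((N : ℝ) + 1)))) ∧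
            ∀ᵐ z ∂(gibbs σ a θ u₀ N Φ), z ∉ B →
              |doob a θ u₀ φ g Λ δv δg d Φ m 0 z| ≤ C_D * b * ((N : ℝ) + 1)

/-- S3′ statement · CONDITIONAL SUB-GAUSSIAN REVISIONS WITH A SUMMABLE PREDICTABLE ALLOWANCE AT A FIXED HORIZON
(dynamical input 2, CLT-scale LD; the r1 re-ordering of 10967's `ConditionalRevisions`: `∀ m ∃ N₀(m)`, constants
`V, C_Ξ, λ₀` independent of `m` and `N`): along the coarse history filtration the Doob martingale of the centred binned
fast window sum over `m` rounds has, for `|λ| ≤ λ₀` and off `𝓕_k`-measurable exceptional sets of mass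
`≤ e^{-C_*(N+1)}`, `E_G[exp(λ (M_{k+1} - M_k)) | 𝓕_k] ≤ exp(V λ² b² (N+1)/2 + |λ| Ξ_k)` with `Ξ_k ≥ 0`
`𝓕_k`-measurable and `Σ_{k<m} Ξ_k ≤ C_Ξ b (N+1)` along good histories. Kill: a hidden quasi-local charge, or conspiracy
amplification of one round's information. Open; the hardest stub. -/
def ConditionalRevisionsFH : Prop :=
  ∀ (a θ : ℝ) (u₀ : V3), 0 < a → 0 < θ → ∃ σ₀ : ℝ, 0 < σ₀ ∧ ∀ σ : ℝ, 0 < σ → σ < σ₀ →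
    ∃ Cstar : ℝ, 0 < Cstar ∧ ∀ (Λ δv δg d : ℝ), ParamsOK θ Λ δv δg d →
      ∀ (b : ℝ) (φ : T3 → ℝ) (g : V3 → ℝ), 0 < b → Adm b φ g →
        ∃ V : ℝ, 0 ≤ V ∧ ∃ C_Ξ : ℝ, 0 ≤ C_Ξ ∧ ∃ lam₀ : ℝ, 0 < lam₀ ∧ ∀ m : ℕ, ∃ N₀ : ℕ, ∀ N : ℕ, N₀ ≤ N →
          ∀ (Φ : Flow σ N),
            ∃ (B : ℕ → Set (Phase N)) (Ξ : ℕ → Phase N → ℝ),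
              (∀ k, MeasurableSet[histSigma θ u₀ φ g Λ δv δg d Φ k] (B k)) ∧
              (∀ k, gibbs σ a θ u₀ N Φ (B k) ≤ ENNReal.ofReal (Real.exp (-(Cstar * ((N : ℝ) + 1))))) ∧
              (∀ k, Measurable[histSigma θ u₀ φ g Λ δv δg d Φ k] (Ξ k)) ∧
              (∀ k z, 0 ≤ Ξ k z) ∧
              (∀ᵐ z ∂(gibbs σ a θ u₀ N Φ), (∀ k, k < m → z ∉ B k) →
                ∑ k ∈ Finset.range m, Ξ k z ≤ C_Ξ * b * ((N : ℝ) + 1)) ∧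
              ∀ lam : ℝ, |lam| ≤ lam₀ → ∀ k : ℕ, k < m →
                ∀ᵐ z ∂(gibbs σ a θ u₀ N Φ), z ∉ B k →
                  condExp (histSigma θ u₀ φ g Λ δv δg d Φ k) (gibbs σ a θ u₀ N Φ)
                      (fun z => Real.exp (lam *
                        (doob a θ u₀ φ g Λ δv δg d Φ m (k + 1) z - doob a θ u₀ φ g Λ δv δg d Φ m k z))) z ≤
                    Real.exp (V * lam ^ 2 * b ^ 2 * ((N : ℝ) + 1) / 2 + |lam| * Ξ k z)

/-- The target of the dock (verbatim the 10967 statement): the twin crux at the windows `τ = m·d`, `m ≥ m₀(δ)`,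
with `N₀` chosen AFTER `m` (`obsA θ u₀ φ g τ Φ z` is the integrand of `KineticFluxLdDecay`). -/
def RoundWindowDecay : Prop :=
  ∀ (a θ : ℝ) (u₀ : V3), 0 < a → 0 < θ → ∃ σ₀ : ℝ, 0 < σ₀ ∧ ∀ σ : ℝ, 0 < σ → σ < σ₀ →
    (∀ (N : ℕ) (Φ : Flow σ N), IsProbabilityMeasure (gibbs σ a θ u₀ N Φ)) ∧
    ∃ κ : ℝ, 0 < κ ∧ ∃ d : ℝ, 0 < d ∧
      ∀ (φ : T3 → ℝ) (g : V3 → ℝ), Continuous φ → Continuous g → (∀ x, |φ x| ≤ 1) →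
        (∀ v, |g v| ≤ κ) →
        (∀ (c₀ c₂ : ℝ) (e : V3), ∫ v, g v * (c₀ + inner ℝ e v + c₂ * ‖v‖ ^ 2) ∂(stdGaussian V3) = 0) →
        ∀ δ : ℝ, 0 < δ → ∃ m₀ : ℕ, 1 ≤ m₀ ∧ ∀ m : ℕ, m₀ ≤ m → ∃ N₀ : ℕ, ∀ N : ℕ, N₀ ≤ N →
          ∀ Φ : Flow σ N,
            ∫⁻ z, ENNReal.ofReal (Real.exp (obsA θ u₀ φ g ((m : ℝ) * d) Φ z)) ∂(gibbs σ a θ u₀ N Φ) ≤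
              ENNReal.ofReal (Real.exp (δ * (N + 1)))

/-! ## Registered stubs -/

/-- **S1 · `stub_slowSectorStatics`** (equal-time statics; size L; identical to the 10967 stub — conditional on the
positions the cell functionals are independent and `O(b)`-sub-exponential, `Γ_g` vanishing to second order by the
three orthogonality clauses; dilute hard-core cluster expansion for the position-dependent means). -/
theorem stub_slowSectorStatics : SlowSectorStatics := by
  sorry

/-- **S2′ · `stub_cellConditionedRelaxationFH`** (DYNAMICAL INPUT 1 — integrated relaxation IN THE MEAN from
coarse-cell-conditioned equilibrium over a horizon fixed before `N → ∞`, `m`-independent constant; open at fixed reduced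
density; FIRST-MOMENT currency; the repaired order). -/
theorem stub_cellConditionedRelaxationFH : CellConditionedRelaxationFH := by
  sorry

/-- **S3′ · `stub_conditionalRevisionsFH`** (DYNAMICAL INPUT 2 — CLT-scale conditional concentration of one-round Doob
revisions given coarse histories, with a summable predictable allowance, at a horizon fixed before `N → ∞`; the
hardest stub). -/
theorem stub_conditionalRevisionsFH : ConditionalRevisionsFH := by
  sorry

/-- **S4′ · `stub_dockFH`** (provable now; size L in Lean; the 10967 dock argument verbatim, which at every step works at
a FIXED horizon `m ≥ m₀(δ)` and then takes `N ≥ N₀(m)`): convexity `e^A ≤ ½e^{(2/m)S_f} + ½e^{(2/m)S_s}`; slow half by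
Jensen in `k`, invariance of `G_N` and S1 at `Λ(δ)`; fast half: binning error `≤ 2(N+1)δg`, the `exp`-supermartingale
`exp(λM_k − Σ_{i<k}(λ²Vb²(N+1)/2 + |λ|Ξ_i))` peeled along `𝓕_k` on the good histories (S3′), the bottom `E e^{λM_0}` by
S2′, bad histories by `κ ≤ C_*/32`; centring by `E_{G_N}F = 0` and the exact orbit identity on the good set. -/
theorem stub_dockFH : SlowSectorStatics → CellConditionedRelaxationFH → ConditionalRevisionsFH →
    RoundWindowDecay := by
  sorry

/-! ## § 3 Composition: the stubs imply the crux X (kernel-checked; no `sorry` from here on) -/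

/-- The dock's target gives the twin crux `KineticFluxLdDecay` (window `τ := m₀ d`; the 10967 composition verbatim). -/
theorem kineticFluxLdDecay_of_roundWindowDecay (hR : RoundWindowDecay) : KineticFluxLdDecay := by
  intro a θ u₀ ha hθ
  obtain ⟨σ₀, hσ₀, H⟩ := hR a θ u₀ ha hθ
  refine ⟨σ₀, hσ₀, fun σ hσ hσlt => ?_⟩
  obtain ⟨hprob, κ, hκ, d, hd, Hφ⟩ := H σ hσ hσlt
  refine ⟨hprob, κ, hκ, fun φ g hφ hg hφ1 hgκ horth δ hδ => ?_⟩
  obtain ⟨m₀, hm₀, Hm⟩ := Hφ φ g hφ hg hφ1 hgκ horth δ hδ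
  obtain ⟨N₀, HN⟩ := Hm m₀ le_rfl
  have hm₀pos : (0 : ℝ) < (m₀ : ℝ) := by exact_mod_cast Nat.lt_of_lt_of_le Nat.zero_lt_one hm₀
  exact ⟨(m₀ : ℝ) * d, mul_pos hm₀pos hd, N₀, fun N hN Φ => HN N hN Φ⟩

/-- **Composition** — the crux X `CorrectorPressureDecay` BY NAME from the four registered stubs: dock, then the twin
crux, then p99142's converse half (`correctorPressureDecay_of_kineticFluxLdDecay`: discrete Fejér corrector). -/
theorem CorrectorPressureDecay_of : CorrectorPressureDecay :=
  Summit.AtomisticToContinuum.HydrodynamicLimit.Theorems.CorrectorPressureDecayEquivalences.correctorPressureDecay_of_kineticFluxLdDecay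
    (kineticFluxLdDecay_of_roundWindowDecay
      (stub_dockFH stub_slowSectorStatics stub_cellConditionedRelaxationFH stub_conditionalRevisionsFH))

end Summit.AtomisticToContinuum.HydrodynamicLimit.Cruxes.CorrectorPressureDecay.CoarseDoobDock

end
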